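import Literature.Barriers.ValiantsHypothesis.AlgebraicNaturalProofs
import Literature.Barriers.ValiantsHypothesis.BDGIL24IsotypicNaturalProofs
import Literature.Computability.AlgebraicComplexity.IMMInVPProofs
import Literature.Computability.AlgebraicComplexity.ArithCircuitVarsCount
import Literature.Computability.AlgebraicComplexity.SparseCircuitBounds
import Literature.Computability.AlgebraicComplexity.DepthThreeVariableReductionProofs
import Literature.Barriers.Schanuel.NesterenkoModularScopeMeasurePolys

/-!
# Route BarrierLever — the NP corpus chain, part 3a: dehomogenisation bookkeeping for the
# van den Berg–Dutta–Gesmundo–Ikenmeyer–Lysikov bridge (cell val-lit, NP corpus lead g5)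

Preliminaries for part 3b (`BarrierLeverNPCorpusChainBDGIL.lean`: `¬ crux ⟹` the class `VP` cut out
by the invariant measure `cc` of [BergEtAl2024] §2.1 HAS algebraic natural proofs in the sense of
[BergEtAl2024] Def. 2.3). This file holds the field-level bookkeeping that does not mention the
diagonal construction:

* affine input gates are cheap and only the `≤ 2 L(G) + 1` variables a circuit reads need paying for
  (`complexity_aeval_le_vars`, via the tree's `card_vars_le_complexity`);
* the dehomogenisation `x₀ ↦ 1` (any `ℓ` with `ℓ 0 = 1`, `ℓ (j+1) = x_j`): degree, and the
  coefficient identity for forms of degree `n` in `n + 1` variables (`coeff_dehom_of_isHomogeneous`);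
* **forms with `cc ≤ r` dehomogenise into FSV's simple class** `SmallCircuits ℂ n b` once
  `r + (2r+1)·4(n+1) ≤ n^b` (`dehom_mem_smallCircuits`), and one exponent `b = c + 6` absorbs a
  p-bounded `r ≤ n^c + c` (`overhead_le_pow`); the quasi-polynomial bookkeeping of `metaVQP`
  (`qp_bound`);
* the simple class is a cone up to one scalar gate (`smul_mem_smallCircuits`); not hitting means an
  equation exists (`exists_eqn_of_not_hitting`, FSV Thm. 4 unfolded); `numMonomials` of the
  format `k(n) = n + 1` is `binom(2n, n)`.

Reused by name: `SaxenaSeshadhri.finsupp_eq_zero_or_single_of_degree_le_one`,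
`Literature.Barriers.Schanuel.degree_cons`, `card_vars_le_complexity`, `complexity_le_card_support_mul`,
`Literature.RingTheory.Nullstellensatz.totalDegree_aeval_le`.

Honest framing: folklore bookkeeping toward a SUFFICIENT condition for the crux
`Theses.BarrierLever.SuccinctHittingSetsForVP` (stmt-ValiantsHypothesis-14610); nothing here bears on
`VP ≠ VNP`. No `sorry`, no named facts, no `def`s (the substitution is a parameter `ℓ` with
`ℓ 0 = 1`, `ℓ (j+1) = x_j`; part 3b instantiates it).

References: [BergEtAl2024] §2.1 (cc, affine linear forms at the inputs), §2.5 (arXiv:2411.03444,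
PDF p.7, p.10–11); [ForbesShpilkaVolk2018] Def. 1, Thm. 4, Cor. 5.
-/

set_option linter.dupNamespace false

noncomputable section

namespace Summit.ValiantsHypothesis.ValiantsHypothesis.Theorems.BarrierLever.NPCorpusChainBDGILPrelims

open MvPolynomial Literature.Barriers.ValiantsHypothesis Literature.Computability.AlgebraicComplexity
open Literature.Barriers.ValiantsHypothesis.BergEtAl2024

/-! ### Elementary bookkeeping -/

/-- A polynomial of total degree `≤ 1` in `n` variables has at most `n + 1` monomials. [folklore] -/
theorem card_support_le_of_totalDegree_le_one {n : ℕ} (p : MvPolynomial (Fin n) ℂ)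
    (hp : p.totalDegree ≤ 1) : p.support.card ≤ n + 1 := by
  classical
  have hsub : p.support ⊆
      insert 0 (Finset.univ.image fun i : Fin n => (Finsupp.single i 1 : Fin n →₀ ℕ)) := by
    intro m hm
    have hdeg : m.degree ≤ 1 := by
      have := le_totalDegree hm
      rw [Finsupp.degree_apply]
      exact this.trans hp
    rcases SaxenaSeshadhri.finsupp_eq_zero_or_single_of_degree_le_one m hdeg with h | ⟨i, h⟩
    · simp [h]
    · exact Finset.mem_insert_of_mem (Finset.mem_image.2 ⟨i, Finset.mem_univ _, h.symm⟩)
  calc p.support.card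
      ≤ (insert 0 (Finset.univ.image fun i : Fin n => (Finsupp.single i 1 : Fin n →₀ ℕ))).card :=
        Finset.card_le_card hsub
    _ ≤ (Finset.univ.image fun i : Fin n => (Finsupp.single i 1 : Fin n →₀ ℕ)).card + 1 :=
        Finset.card_insert_le _ _
    _ ≤ n + 1 := by
        gcongr
        exact Finset.card_image_le.trans (by simp)

/-- **Affine input gates are cheap**: a polynomial of total degree `≤ 1` in `n` variables has
fan-in-two gate count `≤ 4(n + 1)` (sum of its `≤ n + 1` monomials). [folklore] -/
theorem complexity_le_of_totalDegree_le_one {n : ℕ} (p : MvPolynomial (Fin n) ℂ)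
    (hp : p.totalDegree ≤ 1) : complexity p ≤ 4 * (n + 1) := by
  calc complexity p ≤ p.support.card * (2 * p.totalDegree + 2) := complexity_le_card_support_mul p
    _ ≤ (n + 1) * (2 * 1 + 2) := by
        gcongr
        exact card_support_le_of_totalDegree_le_one p hp
    _ = 4 * (n + 1) := by ring

/-- **Substitution with a variable count**: substituting polynomials of gate count `≤ B` into `G`
costs `≤ L(G) + (2 L(G) + 1) · B`, because only the `≤ 2 L(G) + 1` variables that `G` reads
(`card_vars_le_complexity`) need their substituent (the others may be replaced by `0`).
[cite: BergEtAl2024, §2.1, p.7 (affine linear forms at the input gates)] -/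
theorem complexity_aeval_le_vars {m : ℕ} {τ : Type*} (G : MvPolynomial (Fin m) ℂ)
    (L : Fin m → MvPolynomial τ ℂ) {B : ℕ} (hB : ∀ i, complexity (L i) ≤ B) :
    complexity (aeval L G) ≤ complexity G + (2 * complexity G + 1) * B := by
  classical
  let L' : Fin m → MvPolynomial τ ℂ := fun i => if i ∈ G.vars then L i else 0
  have heq : aeval L G = aeval L' G := by
    rw [aeval_eq_eval₂Hom, aeval_eq_eval₂Hom]
    exact eval₂Hom_congr' rfl (fun i hi _ => by simp [L', hi]) rfl
  rw [heq]
  refine (complexity_aeval_le G L').trans ?_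
  gcongr
  calc ∑ i, complexity (L' i) ≤ ∑ i, (if i ∈ G.vars then B else 0) := by
        refine Finset.sum_le_sum fun i _ => ?_
        by_cases hi : i ∈ G.vars
        · simp only [L', hi, if_true]; exact hB i
        · simp only [L', hi, if_false]
          rw [← C_0]
          exact (complexity_C_holds (σ := τ) (0 : ℂ)).le
    _ = G.vars.card * B := by
        rw [Finset.sum_ite_mem, Finset.univ_inter, Finset.sum_const, smul_eq_mul]
    _ ≤ (2 * complexity G + 1) * B := by
        gcongr
        exact card_vars_le_complexity G

/-! ### Dehomogenisation `x₀ ↦ 1` (generic in the substitution `ℓ = (1, x₁, …, x_n)`) -/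

section Dehom

variable {n : ℕ} {ℓ : Fin (n + 1) → MvPolynomial (Fin n) ℂ} (h0 : ℓ 0 = 1) (hs : ∀ j, ℓ j.succ = X j)
include h0 hs

/-- The substituents `1, x₁, …, x_n` have degree `≤ 1`. [folklore] -/
theorem totalDegree_dehomArgs_le (i : Fin (n + 1)) : (ℓ i).totalDegree ≤ 1 := by
  refine Fin.cases ?_ (fun j => ?_) i
  · rw [h0, totalDegree_one]; exact Nat.zero_le _
  · rw [hs]; exact (totalDegree_X _).le

/-- Dehomogenising does not raise the degree. [folklore] -/
theorem totalDegree_dehom_le (p : MvPolynomial (Fin (n + 1)) ℂ) :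
    (aeval ℓ p).totalDegree ≤ p.totalDegree := by
  simpa using Literature.RingTheory.Nullstellensatz.totalDegree_aeval_le ℓ
    (totalDegree_dehomArgs_le h0 hs) p

/-- Dehomogenisation is `x₀ ↦ 1` after Mathlib's `finSuccEquiv`. [folklore] -/
theorem dehom_eq_eval_finSuccEquiv (p : MvPolynomial (Fin (n + 1)) ℂ) :
    aeval ℓ p = Polynomial.eval 1 (finSuccEquiv ℂ n p) := by
  induction p using MvPolynomial.induction_on with
  | C a => simp [finSuccEquiv_apply]
  | add p q hp hq => rw [map_add, map_add, Polynomial.eval_add, hp, hq]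
  | mul_X p i hp =>
      rw [map_mul, map_mul, Polynomial.eval_mul, hp, aeval_X]
      congr 1
      refine Fin.cases ?_ (fun j => ?_) i
      · rw [h0, finSuccEquiv_X_zero, Polynomial.eval_X]
      · rw [hs, finSuccEquiv_X_succ, Polynomial.eval_C]

/-- **Coefficients of the dehomogenisation of a form**: for `f` homogeneous of degree `n` in
`x₀, …, x_n` and `m` of degree `≤ n`, the `x^m`-coefficient of `f(1, x₁, …, x_n)` is the
`x₀^{n - |m|} x^m`-coefficient of `f`. [folklore] -/
theorem coeff_dehom_of_isHomogeneous {f : MvPolynomial (Fin (n + 1)) ℂ}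
    (hf : f.IsHomogeneous n) (m : Fin n →₀ ℕ) (hm : m.degree ≤ n) :
    coeff m (aeval ℓ f) = coeff (Finsupp.cons (n - m.degree) m) f := by
  classical
  rw [dehom_eq_eval_finSuccEquiv h0 hs, Polynomial.eval_eq_sum, Polynomial.sum_def, coeff_sum]
  simp_rw [one_pow, mul_one, finSuccEquiv_coeff_coeff]
  rw [Finset.sum_eq_single (n - m.degree)]
  · intro e _ hne
    refine hf.coeff_eq_zero ?_
    rw [Literature.Barriers.Schanuel.degree_cons]; omega
  · intro h
    rw [← finSuccEquiv_coeff_coeff, Polynomial.notMem_support_iff.1 h, coeff_zero]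

end Dehom

/-! ### Exponent arithmetic -/

/-- One exponent `b = c + 6` absorbs the dehomogenisation overhead of a `cc`-bound `r ≤ n^c + c`,
for all `n ≥ 2`. [folklore] -/
theorem overhead_le_pow (c n r : ℕ) (hn : 2 ≤ n) (hr : r ≤ n ^ c + c) :
    r + (2 * r + 1) * (4 * (n + 1)) ≤ n ^ (c + 6) := by
  set P := n ^ c with hP
  have hP1 : 1 ≤ P := Nat.one_le_pow _ _ (by omega)
  have hcP : c ≤ P := by
    calc c ≤ 2 ^ c := Nat.lt_two_pow_self.le
      _ ≤ n ^ c := Nat.pow_le_pow_left hn c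
  have hr2 : r ≤ 2 * P := by omega
  have h32 : 32 ≤ n ^ 5 := by
    calc 32 = 2 ^ 5 := by norm_num
      _ ≤ n ^ 5 := Nat.pow_le_pow_left hn 5
  have hA : (2 * r + 1) * (4 * (n + 1)) ≤ (5 * P) * (6 * n) :=
    Nat.mul_le_mul (by omega) (by omega)
  have hB : r ≤ 2 * P * n := hr2.trans (Nat.le_mul_of_pos_right _ (by omega))
  calc r + (2 * r + 1) * (4 * (n + 1)) ≤ 2 * P * n + 5 * P * (6 * n) := Nat.add_le_add hB hA
    _ = 32 * P * n := by ring
    _ ≤ n ^ 5 * P * n := by gcongr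
    _ = n ^ (c + 6) := by rw [hP]; ring

/-- The quasi-polynomial bookkeeping of `metaVQP`: `(N^a + 2)² N^a ≤ 2^{(log₂ N + a')^{a'}}` with
`a' = 3a + 4`, for `N ≥ 1`. [folklore] -/
theorem qp_bound (a N t : ℕ) (hN : 1 ≤ N) (ht : t ≤ (N ^ a + 2) ^ 2 * N ^ a) :
    t ≤ 2 ^ ((Nat.log 2 N + (3 * a + 4)) ^ (3 * a + 4)) := by
  set L := Nat.log 2 N with hL
  have hNlt : N < 2 ^ (L + 1) := Nat.lt_pow_succ_log_self one_lt_two N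
  have h1 : N ^ a ≤ 2 ^ ((L + 1) * a) := by
    rw [pow_mul]; exact Nat.pow_le_pow_left hNlt.le a
  have hNa : 1 ≤ N ^ a := Nat.one_le_pow _ _ hN
  have h2 : (N ^ a + 2) ^ 2 * N ^ a ≤ 2 ^ ((L + 1) * (3 * a) + 4) := by
    calc (N ^ a + 2) ^ 2 * N ^ a ≤ (3 * N ^ a) ^ 2 * N ^ a := by gcongr; omega
      _ = 9 * (N ^ a) ^ 3 := by ring
      _ ≤ 16 * (2 ^ ((L + 1) * a)) ^ 3 := by gcongr; norm_num
      _ = 2 ^ ((L + 1) * (3 * a) + 4) := by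
          rw [pow_add, ← pow_mul, show (L + 1) * (3 * a) = (L + 1) * a * 3 by ring]
          ring
  have h3 : (L + 1) * (3 * a) + 4 ≤ (L + (3 * a + 4)) ^ (3 * a + 4) := by
    have hx : 3 * a + 4 ≤ L + (3 * a + 4) := Nat.le_add_left _ _
    calc (L + 1) * (3 * a) + 4 ≤ (L + (3 * a + 4)) * (3 * a + 4) := by nlinarith
      _ ≤ (L + (3 * a + 4)) * (L + (3 * a + 4)) ^ (3 * a + 3) := by
          gcongr
          calc 3 * a + 4 ≤ L + (3 * a + 4) := hx
            _ = (L + (3 * a + 4)) ^ 1 := (pow_one _).symm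
            _ ≤ (L + (3 * a + 4)) ^ (3 * a + 3) := Nat.pow_le_pow_right (by omega) (by omega)
      _ = (L + (3 * a + 4)) ^ (3 * a + 4) := by ring
  calc t ≤ (N ^ a + 2) ^ 2 * N ^ a := ht
    _ ≤ 2 ^ ((L + 1) * (3 * a) + 4) := h2
    _ ≤ 2 ^ ((L + (3 * a + 4)) ^ (3 * a + 4)) := Nat.pow_le_pow_right (by norm_num) h3

/-! ### The simple class under scalars and dehomogenisation -/

/-- `SmallCircuits` is a cone up to one exponent: `c • g ∈ SmallCircuits ℂ n (b + 1)` for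
`g ∈ SmallCircuits ℂ n b`, `n ≥ 2` (one scalar gate, `complexity_smul_le`).
[cite: ForbesShpilkaVolk2018, Cor. 5 (the class of poly-size circuits of degree ≤ d)] -/
theorem smul_mem_smallCircuits {n b : ℕ} (hn : 2 ≤ n) (c : ℂ) {g : MvPolynomial (Fin n) ℂ}
    (hg : g ∈ SmallCircuits ℂ n b) : c • g ∈ SmallCircuits ℂ n (b + 1) := by
  refine ⟨(totalDegree_smul_le c g).trans hg.1, ?_⟩
  have hpow : 1 ≤ n ^ b := Nat.one_le_pow _ _ (by omega)
  calc complexity (c • g) ≤ complexity g + 1 := complexity_smul_le_holds c g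
    _ ≤ n ^ b + 1 := by gcongr; exact hg.2
    _ ≤ n ^ b * n := by nlinarith
    _ = n ^ (b + 1) := (pow_succ _ _).symm

/-- **Forms with cheap `cc` dehomogenise into the simple class**: if `f` is a form of degree `n` in
`n + 1` variables with `cc(f) ≤ r` and `r + (2r + 1)·4(n + 1) ≤ n^b`, then `f(1, x₁, …, x_n)` lies
in `SmallCircuits ℂ n b` (degree `≤ n`, fan-in-two gate count `≤ n^b`, affine inputs paid for).
[cite: BergEtAl2024, §2.1, p.7 (cc); ForbesShpilkaVolk2018, Cor. 5] -/
theorem dehom_mem_smallCircuits {n r b : ℕ} {ℓ : Fin (n + 1) → MvPolynomial (Fin n) ℂ}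
    (h0 : ℓ 0 = 1) (hs : ∀ j, ℓ j.succ = X j) {f : MvPolynomial (Fin (n + 1)) ℂ}
    (hf : f.IsHomogeneous n) (hcc : affComplexity f ≤ r)
    (hb : r + (2 * r + 1) * (4 * (n + 1)) ≤ n ^ b) :
    aeval ℓ f ∈ SmallCircuits ℂ n b := by
  refine ⟨(totalDegree_dehom_le h0 hs f).trans hf.totalDegree_le, ?_⟩
  have hne : {s | ∃ (m : ℕ) (G : MvPolynomial (Fin m) ℂ) (L : Fin m → MvPolynomial (Fin (n + 1)) ℂ),
      (∀ i, (L i).totalDegree ≤ 1) ∧ aeval L G = f ∧ complexity G = s}.Nonempty :=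
    ⟨complexity f, n + 1, f, X, fun i => (totalDegree_X _).le,
      by rw [aeval_X_left, AlgHom.coe_id, id_eq], rfl⟩
  obtain ⟨m, G, L, hL, hG, hc⟩ := Nat.sInf_mem hne
  have hcG : complexity G ≤ r := by rw [hc]; exact hcc
  rw [← hG, ← AlgHom.comp_apply, comp_aeval]
  calc complexity (aeval (fun i => aeval ℓ (L i)) G)
      ≤ complexity G + (2 * complexity G + 1) * (4 * (n + 1)) :=
        complexity_aeval_le_vars G _ fun i =>
          complexity_le_of_totalDegree_le_one _ ((totalDegree_dehom_le h0 hs _).trans (hL i))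
    _ ≤ r + (2 * r + 1) * (4 * (n + 1)) := by gcongr
    _ ≤ n ^ b := hb

/-! ### Equations at a level, and the diagonal of levels -/

/-- Not hitting means an equation exists: a nonzero FSV distinguisher of size and degree
`≤ binom(2n,n)^a` vanishing on (the coefficient vectors of) `SmallCircuits ℂ n b` (FSV Thm. 4,
unfolded). [cite: ForbesShpilkaVolk2018, Def. 1 and Thm. 4] -/
theorem exists_eqn_of_not_hitting {a n b : ℕ}
    (h : ¬ IsSuccinctHittingSet (degLEMonomials n) (SmallCircuits ℂ n b) (Distinguishers ℂ n a)) :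
    ∃ D ∈ Distinguishers ℂ n a, D ≠ 0 ∧
      ∀ g ∈ SmallCircuits ℂ n b, eval (coeffVector (degLEMonomials n) g) D = 0 := by
  simp only [IsSuccinctHittingSet, not_forall, not_exists, not_and, not_not, exists_prop] at h
  obtain ⟨D, hD, hD0, hv⟩ := h
  exact ⟨D, hD, hD0, hv⟩

/-- A nonzero polynomial has a nonzero homogeneous component of degree `≤` its total degree.
[folklore] -/
theorem exists_homogeneousComponent_ne_zero {σ R : Type*} [CommSemiring R] {p : MvPolynomial σ R}
    (hp : p ≠ 0) : ∃ j, j ≤ p.totalDegree ∧ homogeneousComponent j p ≠ 0 := by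
  by_contra h
  push Not at h
  apply hp
  rw [← sum_homogeneousComponent p]
  exact Finset.sum_eq_zero fun j hj => h j (by simpa [Nat.lt_succ_iff] using hj)

/-- `numMonomials` of the format `k(n) = n + 1` is `binom(2n, n)`. [cite: BergEtAl2024, §2.5, p.10] -/
theorem numMonomials_succ (n : ℕ) : numMonomials (fun n => n + 1) n = (2 * n).choose n := by
  simp only [numMonomials]
  congr 1
  omega

end Summit.ValiantsHypothesis.ValiantsHypothesis.Theorems.BarrierLever.NPCorpusChainBDGILPrelims

end
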